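import Summits.BirchSwinnertonDyer.BirchSwinnertonDyer.Theorems.Rank1ResidualIntModelReduction
import Summits.BirchSwinnertonDyer.Rank1Residual.Additive.DictionaryUniform
import HarnessLib

/-!
# Route `KatoDescentTamePotSupersingular` (rung K8, sub-rung B4 (t′), cell `bsd-potss`): a kernel TOOL for the per-row unit-twist records —
# the census cell (t′) `SubTprime W p` at a prime `p ≥ 5` read off the integer model (seat `bsd-potss-k8t-c4` g14; route-free;
# 0 definitions, 0 named facts, 0 `sorry`; closes nothing)

WHY. The U₀-ns rows of items 19202 / 19982 are (t′) rows: `SubTprime W p := ¬ PotMult W p ∧ CondExpTwo W p ∧ ¬ e ∣ p − 1` with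
`e = 12 / gcd(12, ord_p Δ_min)` the semistability index. At `p ≥ 5` all three conjuncts are kernel-checkable on a literal globally minimal
model: `¬ PotMult` is `ord_p j ≥ 0`; `CondExpTwo` is automatic for an additive `p ≥ 5` (`condExpTwo_of_addv_of_five_le`, Silverman ATAEC
IV.10.4); and `ord_p Δ_min = b` is read off `pᵇ ∣ Δ(E₀)`, `p^{b+1} ∤ Δ(E₀)`. (At `p = 3` the conductor exponent is not automatic and the
tree's dictionary `subTprime_three_iff_kodairaSymbolAt_III_or_IIIstar` needs the Kodaira symbol; not covered here.)

References: [SilvermanATAEC1994] IV.10.2(b), IV.10.4; [SilvermanAEC2009] VII.5 Prop. 5.5; [Delbourgo1998] §1.5.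
-/

set_option autoImplicit false
-- the Theorems directory repeats the summit name (sibling precedent `KatoDescentPotSupersingularAssembly.lean`)
set_option linter.dupNamespace false

noncomputable section

open scoped Classical

namespace Summit.BirchSwinnertonDyer.BirchSwinnertonDyer.Theorems.TameUpperUnitTwistRecords

open WeierstrassCurve Summit.BirchSwinnertonDyer.BirchSwinnertonDyer.Rank1Residual.IntModel
  Literature.NumberTheory.EllipticCurves Literature.NumberTheory.EllipticCurves.Rank1Residual
  Summit.BirchSwinnertonDyer.Rank1Residual Summit.BirchSwinnertonDyer.Rank1Residual.Additive

/-- **The (t′) cell `SubTprime W p` at `p ≥ 5` from the integer model.** For a globally minimal `W/ℚ` with integer model `E₀`, an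
additive prime `p ≥ 5` (`hadd`) with `ord_p j(W) ≥ 0` (`hj`, not potentially multiplicative), `ord_p Δ(E₀) = b` (`pᵇ ∣ Δ`, `p^{b+1} ∤ Δ`)
and semistability index `e = 12 / gcd(12, b)` NOT dividing `p − 1`: the pair lies on the census cell (t′) (tame potentially supersingular,
`e ∈ {3,4,6}`, `e ∣ p + 1`). `CondExpTwo` is automatic at an additive `p ≥ 5` (Silverman ATAEC IV.10.4, tree
`condExpTwo_of_addv_of_five_le`). [cite: SilvermanATAEC1994, IV.10.4] [cite: SilvermanAEC2009, VII.5 Prop. 5.5] [cite: Delbourgo1998, §1.5] -/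
theorem subTprime_of_intModel {W : WeierstrassCurve ℚ} [W.IsElliptic] [W.IsGloballyMinimal]
    {E₀ : WeierstrassCurve ℤ} (hI : integralModelInt W = E₀) (p : ℕ) [hp : Fact p.Prime] (hp5 : 5 ≤ p)
    (hadd : Addv W p) (hj : 0 ≤ padicValRat p W.j)
    {b : ℕ} (hb : (p : ℤ) ^ b ∣ E₀.Δ) (hb' : ¬ (p : ℤ) ^ (b + 1) ∣ E₀.Δ) (he : ¬ (12 / Nat.gcd 12 b) ∣ p - 1) :
    SubTprime W p := by
  refine ⟨not_lt.mpr hj, condExpTwo_of_addv_of_five_le W p hp5 hadd, ?_⟩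
  have hv : padicValInt p W.minimalDiscriminantInt = b := by
    rw [minimalDiscriminantInt_eq hI]
    exact padicValInt_eq_of_dvd_of_not_dvd p hb hb'
  unfold semistabilityIndex
  rw [hv]
  exact he

end Summit.BirchSwinnertonDyer.BirchSwinnertonDyer.Theorems.TameUpperUnitTwistRecords
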